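import Summits.RiemannHypothesis.RiemannHypothesis.Theorems.WeilWindowFlowGronwallLeakageIffWeilPos
import Summits.RiemannHypothesis.RiemannHypothesis.Theorems.GronwallLeakage.Negative.LoadBearing
import Literature.NumberTheory.LFunctions.WeilWindowSuzukiContinuityProofs
import HarnessLib

/-!
# `GronwallLeakage` (crux stmt-RiemannHypothesis-1037, route WeilWindowFlow) — the maximal flow
interval and the conjugate-point alternative (line `Sketch`, lead c6; all UNCONDITIONAL)

The route treats the window half-width `a` as TIME and its thesis `X = GronwallLeakage` as "the Grönwall
flow of the bottom `ε = weilGroundEnergy` never reaches a conjugate point". This file makes that picture a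
set of kernel-checked theorems, with no hypothesis:

* §1 **The law holds below any conjugate point, with the canonical rate.** For `0 < b ≤ a` with
  `0 < ε a`, the rate `C₀ := -(log ∘ ε)'` is integrable on `[b, a]` and
  `ε b · exp (-∫_b^a C₀) = ε a` EXACTLY (`leakage_identity_of_pos`): `ε` is absolutely continuous on
  `[b, a]` (`weilGroundEnergy_absolutelyContinuousOnInterval`, from the closed crux `WindowLipschitz`),
  takes values in `[ε a, ∞)` where `log` is Lipschitz, and the FTC for absolutely continuous functions
  applies. Hence `X` holds verbatim on every initial segment `(0, A]` with `0 < ε A`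
  (`leakage_law_on_of_pos`), in particular on some `(0, A]` with `A > (log 2)/2`, i.e. with the prime `2`
  inside the window (`gronwallLeakage_on_initial_segment`; dyadic anchor `strictArchimedeanBottom_proof`
  + continuity `continuousAt_weilGroundEnergy`). `X` itself is the law with the canonical rate
  (`gronwallLeakage_iff_canonicalRate`).
* §2 **First conjugate point.** If `ε a ≤ 0` at some window then there is a unique `a⋆ > (log 2)/2` with
  `ε > 0` on `(0, a⋆)`, `ε a⋆ = 0`, `ε ≤ 0` on `[a⋆, ∞)` (`exists_first_conjugatePoint`,
  `conjugatePoint_unique`): the maximal existence interval of the flow is `(0, a⋆)`.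
* §3 **Blow-up alternative.** `X ∨ (∃ a⋆ > (log 2)/2` first conjugate point, with `ε < 0` on a half-line
  beyond it`)` (`gronwallLeakage_or_conjugatePoint`); `X ⟺ ε` never vanishes on `(0, ∞)`
  (`gronwallLeakage_iff_forall_ne_zero`) `⟺ ε ≥ 0` on `(0, ∞)` (`gronwallLeakage_iff_forall_nonneg`);
  the same for RH (`riemannHypothesis_iff_weilGroundEnergy_ne_zero`).
* §4 **The rate blows up at a conjugate point.** ANY rate obeying the two-window law on `[b, a⋆)` has
  `∫_b^a C → +∞` as `a → a⋆⁻` and is not integrable on `[b, a⋆]`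
  (`rate_integral_tendsto_atTop_of_conjugatePoint`, `rate_not_intervalIntegrable_of_conjugatePoint`) —
  the finite-time companion of the tightness theorems at `0⁺` (`Negative/LoadBearing.lean`) and at `+∞`
  (`TightnessAtTop.lean`).

So, unconditionally: the Grönwall flow exists on a maximal interval `(0, a⋆)`, `a⋆ ∈ ((log 2)/2, +∞]`,
with the canonical locally integrable rate; `a⋆ = +∞ ⟺ X ⟺ RH`; and the only way `X` can fail is a
finite conjugate point at which every admissible rate ceases to be integrable — never a "singular drop"
of `log ε` at positive level (excluded by `WindowLipschitz_proof`). What remains of the crux is exactly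
`a⋆ = +∞`, i.e. item stmt-RiemannHypothesis-0098 (`gronwallLeakage_iff_uniformWeilPositivity`).

Axioms ⊆ {propext, Classical.choice, Quot.sound}.
-/

-- `Summit.RiemannHypothesis.RiemannHypothesis.…` repeats a namespace component by design (D-0017 layout).
set_option linter.dupNamespace false

noncomputable section

open MeasureTheory Set Filter
open scoped Topology NNReal

namespace Summit.RiemannHypothesis.RiemannHypothesis.Theorems.WeilWindowFlowGronwallLeakage

open Literature.NumberTheory.LFunctions
open Summit.RiemannHypothesis.RiemannHypothesis.Theses.WeilWindowFlow
open Summit.RiemannHypothesis.Cruxes.GronwallLeakage.Negative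

/-! ## §1 The leakage law below a conjugate point, with the canonical rate -/

/-- **Local `LogAC`.** If the bottom is still positive at the right end of `[b, a] ⊂ (0, ∞)`, then `log ε`
is absolutely continuous on `[b, a]`: `ε` is absolutely continuous there
(`weilGroundEnergy_absolutelyContinuousOnInterval`), antitone with values in `[ε a, ∞)`, and `log` is
`(ε a)⁻¹`-Lipschitz on `[ε a, ∞)`. [folklore] -/
theorem logAC_of_pos_right {b a : ℝ} (hb : 0 < b) (hba : b ≤ a) (hεa : 0 < weilGroundEnergy a) :
    AbsolutelyContinuousOnInterval (fun x ↦ Real.log (weilGroundEnergy x)) b a := by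
  have hlip : LipschitzOnWith (Real.toNNReal (weilGroundEnergy a)⁻¹) Real.log
      (Ici (weilGroundEnergy a)) := by
    refine LipschitzOnWith.of_dist_le_mul fun x hx y hy ↦ ?_
    rw [Real.coe_toNNReal _ (inv_nonneg.2 hεa.le)]
    exact dist_log_le_inv_mul_dist hεa hx hy
  have hmaps : MapsTo weilGroundEnergy (uIcc b a) (Ici (weilGroundEnergy a)) := by
    intro x hx
    rw [uIcc_of_le hba] at hx
    exact weilGroundEnergy_antitone_of_pos' (hb.trans_le hx.1) hx.2
  exact (weilGroundEnergy_absolutelyContinuousOnInterval hb hba).comp_of_lipschitzOnWith hlip hmaps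

/-- **The leakage identity below a conjugate point.** For `0 < b ≤ a` with `0 < ε a`, the canonical rate
`C₀ = -(log ∘ ε)'` is integrable on `[b, a]` and `ε b · exp (-∫_b^a C₀) = ε a` exactly (FTC for the
absolutely continuous function `log ∘ ε`). [folklore] -/
theorem leakage_identity_of_pos {b a : ℝ} (hb : 0 < b) (hba : b ≤ a) (hεa : 0 < weilGroundEnergy a) :
    IntervalIntegrable (fun x ↦ -deriv (fun y ↦ Real.log (weilGroundEnergy y)) x) volume b a ∧
      weilGroundEnergy b *
          Real.exp (-(∫ x in b..a, -deriv (fun y ↦ Real.log (weilGroundEnergy y)) x)) =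
        weilGroundEnergy a := by
  have hAC := logAC_of_pos_right hb hba hεa
  have hεb : 0 < weilGroundEnergy b := hεa.trans_le (weilGroundEnergy_antitone_of_pos' hb hba)
  refine ⟨hAC.intervalIntegrable_deriv.neg, ?_⟩
  rw [intervalIntegral.integral_neg, neg_neg, hAC.integral_deriv_eq_sub, Real.exp_sub,
    Real.exp_log hεa, Real.exp_log hεb, mul_div_cancel₀ _ hεb.ne']

/-- Positivity propagates to the left: `0 < ε A` and `0 < a ≤ A` give `0 < ε a` (antitonicity). [folklore] -/
theorem weilGroundEnergy_pos_of_le {A a : ℝ} (hεA : 0 < weilGroundEnergy A) (ha : 0 < a)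
    (haA : a ≤ A) : 0 < weilGroundEnergy a :=
  hεA.trans_le (weilGroundEnergy_antitone_of_pos' ha haA)

/-- **`X` holds verbatim on every initial segment `(0, A]` on which the bottom is still positive**, with
the canonical rate `C₀ = -(log ∘ ε)'`: for `0 < b ≤ a ≤ A`, `C₀` is integrable on `[b, a]` and
`ε b · exp (-∫_b^a C₀) ≤ ε a` (in fact `=`). Unconditional. [folklore] -/
theorem leakage_law_on_of_pos {A : ℝ} (hεA : 0 < weilGroundEnergy A) :
    ∀ b a : ℝ, 0 < b → b ≤ a → a ≤ A →
      IntervalIntegrable (fun x ↦ -deriv (fun y ↦ Real.log (weilGroundEnergy y)) x) volume b a ∧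
      weilGroundEnergy b *
          Real.exp (-(∫ x in b..a, -deriv (fun y ↦ Real.log (weilGroundEnergy y)) x)) ≤
        weilGroundEnergy a := by
  intro b a hb hba haA
  obtain ⟨hint, heq⟩ :=
    leakage_identity_of_pos hb hba (weilGroundEnergy_pos_of_le hεA (hb.trans_le hba) haA)
  exact ⟨hint, heq.le⟩

/-- **`X` is the law with the canonical rate.** `GronwallLeakage` holds iff the two-window law holds with
the specific rate `C₀ = -(log ∘ ε)'` (so a witness `C` is never the issue — only positivity of `ε` is).
[folklore] -/
theorem gronwallLeakage_iff_canonicalRate :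
    GronwallLeakage ↔ ∀ b a : ℝ, 0 < b → b ≤ a →
      IntervalIntegrable (fun x ↦ -deriv (fun y ↦ Real.log (weilGroundEnergy y)) x) volume b a ∧
      weilGroundEnergy b *
          Real.exp (-(∫ x in b..a, -deriv (fun y ↦ Real.log (weilGroundEnergy y)) x)) ≤
        weilGroundEnergy a := by
  constructor
  · intro hX b a hb hba
    exact leakage_law_on_of_pos (weilGroundEnergy_pos_of_gronwallLeakage hX (hb.trans_le hba))
      b a hb hba le_rfl
  · intro h
    exact ⟨_, h⟩

/-- Strict positivity of the bottom persists strictly beyond the dyadic window: some `A > (log 2)/2` has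
`0 < ε A` (`strictArchimedeanBottom_proof` and continuity of `ε` at `(log 2)/2`). [folklore] -/
theorem exists_gt_log_two_half_weilGroundEnergy_pos :
    ∃ A : ℝ, Real.log 2 / 2 < A ∧ 0 < weilGroundEnergy A := by
  have ha₀ : 0 < Real.log 2 / 2 := by
    have := Real.log_pos one_lt_two
    positivity
  have hpos : 0 < weilGroundEnergy (Real.log 2 / 2) :=
    Summit.RiemannHypothesis.RiemannHypothesis.Theorems.strictArchimedeanBottom_proof
  have hcont : ContinuousAt weilGroundEnergy (Real.log 2 / 2) := continuousAt_weilGroundEnergy ha₀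
  have hev : ∀ᶠ x in 𝓝 (Real.log 2 / 2), 0 < weilGroundEnergy x :=
    hcont.eventually (lt_mem_nhds hpos)
  have hev' : ∀ᶠ x in 𝓝[>] (Real.log 2 / 2), 0 < weilGroundEnergy x ∧ Real.log 2 / 2 < x :=
    (hev.filter_mono nhdsWithin_le_nhds).and self_mem_nhdsWithin
  obtain ⟨x, hx, hxa⟩ := hev'.exists
  exact ⟨x, hxa, hx⟩

/-- **The unconditional initial segment of `X`.** There is `A > (log 2)/2` (the prime `2` inside the
window) and a rate `C` such that the crux's law — `C` integrable on `[b, a]` and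
`ε b · exp (-∫_b^a C) ≤ ε a` — holds for all `0 < b ≤ a ≤ A`. [folklore] -/
theorem gronwallLeakage_on_initial_segment :
    ∃ A : ℝ, Real.log 2 / 2 < A ∧ ∃ C : ℝ → ℝ, ∀ b a : ℝ, 0 < b → b ≤ a → a ≤ A →
      IntervalIntegrable C volume b a ∧
      weilGroundEnergy b * Real.exp (-(∫ x in b..a, C x)) ≤ weilGroundEnergy a := by
  obtain ⟨A, hA, hεA⟩ := exists_gt_log_two_half_weilGroundEnergy_pos
  exact ⟨A, hA, _, leakage_law_on_of_pos hεA⟩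

/-! ## §2 The first conjugate point -/

/-- **First conjugate point.** If the bottom is `≤ 0` at some window, then there is `a⋆ > (log 2)/2` with
`ε > 0` on `(0, a⋆)`, `ε a⋆ = 0` and `ε ≤ 0` on `[a⋆, ∞)`: `a⋆ = inf {a > 0 | ε a ≤ 0}`; the set is an
up-set by antitonicity, bounded below by the positive initial segment, and `ε a⋆ = 0` by continuity of
`ε` at `a⋆` (`continuousAt_weilGroundEnergy`). [folklore] -/
theorem exists_first_conjugatePoint (h : ∃ a : ℝ, 0 < a ∧ weilGroundEnergy a ≤ 0) :
    ∃ aStar : ℝ, Real.log 2 / 2 < aStar ∧ weilGroundEnergy aStar = 0 ∧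
      (∀ a : ℝ, 0 < a → a < aStar → 0 < weilGroundEnergy a) ∧
      (∀ a : ℝ, aStar ≤ a → weilGroundEnergy a ≤ 0) := by
  obtain ⟨a₁, ha₁, hε₁⟩ := h
  obtain ⟨A, hA, hεA⟩ := exists_gt_log_two_half_weilGroundEnergy_pos
  have hlog : 0 < Real.log 2 / 2 := by
    have := Real.log_pos one_lt_two
    positivity
  have hA0 : 0 < A := hlog.trans hA
  set S : Set ℝ := {a : ℝ | 0 < a ∧ weilGroundEnergy a ≤ 0} with hS
  have hne : S.Nonempty := ⟨a₁, ha₁, hε₁⟩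
  -- `A` is a strict lower bound of `S`
  have hlow : ∀ a ∈ S, A < a := by
    rintro a ⟨ha, hεa⟩
    by_contra hle
    push Not at hle
    exact (weilGroundEnergy_pos_of_le hεA ha hle).not_ge hεa
  have hbdd : BddBelow S := ⟨A, fun a ha ↦ (hlow a ha).le⟩
  have hAle : A ≤ sInf S := le_csInf hne fun a ha ↦ (hlow a ha).le
  have hS0 : 0 < sInf S := hA0.trans_le hAle
  -- before `sInf S`: positive
  have hbefore : ∀ a : ℝ, 0 < a → a < sInf S → 0 < weilGroundEnergy a := by
    intro a ha hlt
    by_contra hle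
    push Not at hle
    exact (csInf_le hbdd ⟨ha, hle⟩).not_gt hlt
  -- after `sInf S`: nonpositive
  have hafter : ∀ a : ℝ, sInf S < a → weilGroundEnergy a ≤ 0 := by
    intro a hlt
    obtain ⟨s, hs, hsa⟩ := (csInf_lt_iff hbdd hne).1 hlt
    exact (weilGroundEnergy_antitone_of_pos' hs.1 hsa.le).trans hs.2
  -- at `sInf S`: zero, by continuity from both sides
  have hcont : ContinuousAt weilGroundEnergy (sInf S) := continuousAt_weilGroundEnergy hS0
  have hge : 0 ≤ weilGroundEnergy (sInf S) := by
    have h1 : Tendsto weilGroundEnergy (𝓝[<] sInf S) (𝓝 (weilGroundEnergy (sInf S))) :=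
      hcont.tendsto.mono_left nhdsWithin_le_nhds
    have h0 : ∀ᶠ a in 𝓝[<] sInf S, 0 < a := (lt_mem_nhds hS0).filter_mono nhdsWithin_le_nhds
    have h2 : ∀ᶠ a in 𝓝[<] sInf S, 0 ≤ weilGroundEnergy a := by
      filter_upwards [h0, self_mem_nhdsWithin] with a ha hlt
      exact (hbefore a ha hlt).le
    exact ge_of_tendsto h1 h2
  have hle : weilGroundEnergy (sInf S) ≤ 0 := by
    have h1 : Tendsto weilGroundEnergy (𝓝[>] sInf S) (𝓝 (weilGroundEnergy (sInf S))) :=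
      hcont.tendsto.mono_left nhdsWithin_le_nhds
    have h2 : ∀ᶠ a in 𝓝[>] sInf S, weilGroundEnergy a ≤ 0 := by
      filter_upwards [self_mem_nhdsWithin] with a hlt
      exact hafter a hlt
    exact le_of_tendsto h1 h2
  have hzero : weilGroundEnergy (sInf S) = 0 := le_antisymm hle hge
  refine ⟨sInf S, hA.trans_le hAle, hzero, hbefore, fun a ha ↦ ?_⟩
  rcases ha.eq_or_lt with h | h
  · rw [← h, hzero]
  · exact hafter a h

/-- **Uniqueness of the conjugate point**: two windows at which `ε` vanishes with `ε > 0` before coincide.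
[folklore] -/
theorem conjugatePoint_unique {s t : ℝ} (hs0 : 0 < s) (ht0 : 0 < t)
    (hs : weilGroundEnergy s = 0) (hs' : ∀ a : ℝ, 0 < a → a < s → 0 < weilGroundEnergy a)
    (ht : weilGroundEnergy t = 0) (ht' : ∀ a : ℝ, 0 < a → a < t → 0 < weilGroundEnergy a) :
    s = t := by
  by_contra hne
  rcases lt_or_gt_of_ne hne with h | h
  · exact (ht' s hs0 h).ne' hs
  · exact (hs' t ht0 h).ne' ht

/-! ## §3 The blow-up alternative: `X` or a first conjugate point -/

/-- **`¬X` produces a first conjugate point with a negative tail.** If `GronwallLeakage` fails then RH fails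
(`gronwallLeakage_iff_riemannHypothesis`), so `ε a₁ < 0` somewhere
(`exists_weilGroundEnergy_neg_of_not_riemannHypothesis`); the first conjugate point `a⋆ > (log 2)/2` has
`ε > 0` before it, `ε a⋆ = 0`, `ε ≤ 0` after it, and `ε < 0` on `[a₁, ∞)` for some `a₁ > a⋆`. [folklore] -/
theorem exists_conjugatePoint_of_not_gronwallLeakage (hX : ¬ GronwallLeakage) :
    ∃ aStar : ℝ, Real.log 2 / 2 < aStar ∧ weilGroundEnergy aStar = 0 ∧
      (∀ a : ℝ, 0 < a → a < aStar → 0 < weilGroundEnergy a) ∧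
      (∀ a : ℝ, aStar ≤ a → weilGroundEnergy a ≤ 0) ∧
      (∃ a₁ : ℝ, aStar < a₁ ∧ ∀ a : ℝ, a₁ ≤ a → weilGroundEnergy a < 0) := by
  have hRH : ¬ _root_.RiemannHypothesis := fun h ↦ hX (gronwallLeakage_iff_riemannHypothesis.2 h)
  obtain ⟨a₁, ha₁, hε₁⟩ := exists_weilGroundEnergy_neg_of_not_riemannHypothesis hRH
  obtain ⟨aStar, hgt, hzero, hbefore, hafter⟩ := exists_first_conjugatePoint ⟨a₁, ha₁, hε₁.le⟩
  refine ⟨aStar, hgt, hzero, hbefore, hafter, a₁, ?_, fun a ha ↦ ?_⟩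
  · by_contra hle
    push Not at hle
    rcases hle.eq_or_lt with h | h
    · rw [h] at hε₁
      exact hε₁.ne hzero
    · exact (hbefore a₁ ha₁ h).not_gt hε₁
  · exact (weilGroundEnergy_antitone_of_pos' ha₁ ha).trans_lt hε₁

/-- **MAXIMAL FLOW THEOREM (blow-up alternative), unconditional.** Either the Grönwall leakage law `X`
holds on all of `(0, ∞)`, or the flow has a first conjugate point `a⋆ > (log 2)/2`: `ε > 0` on `(0, a⋆)`
(where the law holds with the canonical rate, `leakage_law_on_of_pos`), `ε a⋆ = 0`, `ε ≤ 0` on `[a⋆, ∞)`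
and `ε < 0` on a half-line. [folklore] -/
theorem gronwallLeakage_or_conjugatePoint :
    GronwallLeakage ∨
      ∃ aStar : ℝ, Real.log 2 / 2 < aStar ∧ weilGroundEnergy aStar = 0 ∧
        (∀ a : ℝ, 0 < a → a < aStar → 0 < weilGroundEnergy a) ∧
        (∀ a : ℝ, aStar ≤ a → weilGroundEnergy a ≤ 0) ∧
        (∃ a₁ : ℝ, aStar < a₁ ∧ ∀ a : ℝ, a₁ ≤ a → weilGroundEnergy a < 0) := by
  by_cases hX : GronwallLeakage
  · exact Or.inl hX
  · exact Or.inr (exists_conjugatePoint_of_not_gronwallLeakage hX)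

/-- **`X ⟺` no conjugate point**: `GronwallLeakage` holds iff the bottom never vanishes on `(0, ∞)`.
[folklore] -/
theorem gronwallLeakage_iff_forall_ne_zero :
    GronwallLeakage ↔ ∀ a : ℝ, 0 < a → weilGroundEnergy a ≠ 0 := by
  constructor
  · exact fun hX a ha ↦ (weilGroundEnergy_pos_of_gronwallLeakage hX ha).ne'
  · intro h
    by_contra hX
    obtain ⟨aStar, hgt, hzero, -⟩ := exists_conjugatePoint_of_not_gronwallLeakage hX
    have hlog : 0 < Real.log 2 / 2 := by
      have := Real.log_pos one_lt_two
      positivity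
    exact h aStar (hlog.trans hgt) hzero

/-- **`X ⟺ ε ≥ 0` on `(0, ∞)`** (non-strict positivity already suffices: a window with `ε ≤ 0` forces a
window with `ε < 0` further out). [folklore] -/
theorem gronwallLeakage_iff_forall_nonneg :
    GronwallLeakage ↔ ∀ a : ℝ, 0 < a → 0 ≤ weilGroundEnergy a := by
  constructor
  · exact fun hX a ha ↦ (weilGroundEnergy_pos_of_gronwallLeakage hX ha).le
  · intro h
    by_contra hX
    obtain ⟨aStar, hgt, -, -, -, a₁, h₁, h₂⟩ := exists_conjugatePoint_of_not_gronwallLeakage hX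
    have hlog : 0 < Real.log 2 / 2 := by
      have := Real.log_pos one_lt_two
      positivity
    exact (h₂ a₁ le_rfl).not_ge (h a₁ ((hlog.trans hgt).trans h₁))

/-- **RH ⟺ the window bottom never vanishes** (equivalently: no conjugate point of the Grönwall flow).
[folklore] -/
theorem riemannHypothesis_iff_weilGroundEnergy_ne_zero :
    _root_.RiemannHypothesis ↔ ∀ a : ℝ, 0 < a → weilGroundEnergy a ≠ 0 :=
  gronwallLeakage_iff_riemannHypothesis.symm.trans gronwallLeakage_iff_forall_ne_zero

/-- **`¬RH` located.** If RH fails, the failure is a first conjugate point `a⋆ > (log 2)/2` of the flow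
(never before the prime `2` enters the window): `ε > 0` on `(0, a⋆)`, `ε a⋆ = 0`, `ε ≤ 0` on `[a⋆, ∞)`,
`ε < 0` on a half-line. [folklore] -/
theorem exists_conjugatePoint_of_not_riemannHypothesis (hRH : ¬ _root_.RiemannHypothesis) :
    ∃ aStar : ℝ, Real.log 2 / 2 < aStar ∧ weilGroundEnergy aStar = 0 ∧
      (∀ a : ℝ, 0 < a → a < aStar → 0 < weilGroundEnergy a) ∧
      (∀ a : ℝ, aStar ≤ a → weilGroundEnergy a ≤ 0) ∧
      (∃ a₁ : ℝ, aStar < a₁ ∧ ∀ a : ℝ, a₁ ≤ a → weilGroundEnergy a < 0) :=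
  exists_conjugatePoint_of_not_gronwallLeakage fun hX ↦ hRH (gronwallLeakage_iff_riemannHypothesis.1 hX)

/-! ## §4 The rate blows up at a conjugate point -/

/-- **Blow-up of the rate at a conjugate point.** If `ε > 0` on `(0, a⋆)`, `ε a⋆ = 0`, and a rate `C` obeys
the two-window law `ε b · exp (-∫_b^a C) ≤ ε a` for `b ≤ a < a⋆` (some `0 < b < a⋆`), then
`∫_b^a C → +∞` as `a → a⋆⁻` (since `∫_b^a C ≥ log ε b - log ε a` and `ε a → 0⁺` by continuity).
[folklore] -/
theorem rate_integral_tendsto_atTop_of_conjugatePoint {C : ℝ → ℝ} {aStar b : ℝ}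
    (hb : 0 < b) (hbS : b < aStar) (hzero : weilGroundEnergy aStar = 0)
    (hpos : ∀ a : ℝ, 0 < a → a < aStar → 0 < weilGroundEnergy a)
    (hlaw : ∀ a : ℝ, b ≤ a → a < aStar →
      weilGroundEnergy b * Real.exp (-(∫ x in b..a, C x)) ≤ weilGroundEnergy a) :
    Tendsto (fun a ↦ ∫ x in b..a, C x) (𝓝[<] aStar) atTop := by
  have haS : 0 < aStar := hb.trans hbS
  have hεb : 0 < weilGroundEnergy b := hpos b hb hbS
  have hevb : ∀ᶠ a in 𝓝[<] aStar, b < a := (lt_mem_nhds hbS).filter_mono nhdsWithin_le_nhds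
  -- `ε a → 0⁺` as `a → a⋆⁻`
  have hcont : ContinuousAt weilGroundEnergy aStar := continuousAt_weilGroundEnergy haS
  have hT : Tendsto weilGroundEnergy (𝓝[<] aStar) (𝓝[>] 0) := by
    refine tendsto_nhdsWithin_iff.2 ⟨?_, ?_⟩
    · simpa only [hzero] using hcont.tendsto.mono_left nhdsWithin_le_nhds
    · filter_upwards [hevb, self_mem_nhdsWithin] with a hba hlt
      exact hpos a (hb.trans hba) hlt
  -- hence `log ε b - log ε a → +∞`
  have hlog : Tendsto (fun a ↦ Real.log (weilGroundEnergy b) + -Real.log (weilGroundEnergy a))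
      (𝓝[<] aStar) atTop :=
    tendsto_atTop_add_const_left _ _
      (tendsto_neg_atBot_atTop.comp (Real.tendsto_log_nhdsGT_zero.comp hT))
  -- and the law gives `log ε b - log ε a ≤ ∫_b^a C`
  have key : ∀ᶠ a in 𝓝[<] aStar,
      Real.log (weilGroundEnergy b) + -Real.log (weilGroundEnergy a) ≤ ∫ x in b..a, C x := by
    filter_upwards [hevb, self_mem_nhdsWithin] with a hba hlt
    have h := hlaw a hba.le hlt
    have h' := Real.log_le_log (mul_pos hεb (Real.exp_pos _)) h
    rw [Real.log_mul hεb.ne' (Real.exp_pos _).ne', Real.log_exp] at h'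
    linarith
  exact tendsto_atTop_mono' _ key hlog

/-- **No admissible rate is integrable up to a conjugate point**: under the hypotheses of
`rate_integral_tendsto_atTop_of_conjugatePoint`, `C ∉ L¹(b, a⋆)` — the finite-time companion of
`gronwallLeakage_rate_not_intervalIntegrable_from_zero` (at `0⁺`) and
`gronwallLeakage_false_with_rate_integrable_at_top` (at `+∞`). [folklore] -/
theorem rate_not_intervalIntegrable_of_conjugatePoint {C : ℝ → ℝ} {aStar b : ℝ}
    (hb : 0 < b) (hbS : b < aStar) (hzero : weilGroundEnergy aStar = 0)
    (hpos : ∀ a : ℝ, 0 < a → a < aStar → 0 < weilGroundEnergy a)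
    (hlaw : ∀ a : ℝ, b ≤ a → a < aStar →
      weilGroundEnergy b * Real.exp (-(∫ x in b..a, C x)) ≤ weilGroundEnergy a) :
    ¬ IntervalIntegrable C volume b aStar := by
  intro hint
  have hT := rate_integral_tendsto_atTop_of_conjugatePoint hb hbS hzero hpos hlaw
  have hevb : ∀ᶠ a in 𝓝[<] aStar, b < a := (lt_mem_nhds hbS).filter_mono nhdsWithin_le_nhds
  have hbound : ∀ᶠ a in 𝓝[<] aStar, ∫ x in b..a, C x ≤ ∫ x in b..aStar, |C x| := by
    filter_upwards [hevb, self_mem_nhdsWithin] with a hba hlt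
    calc ∫ x in b..a, C x ≤ |∫ x in b..a, C x| := le_abs_self _
      _ ≤ ∫ x in b..a, |C x| := intervalIntegral.abs_integral_le_integral_abs hba.le
      _ ≤ ∫ x in b..aStar, |C x| :=
          intervalIntegral.integral_mono_interval le_rfl hba.le hlt.le
            (Eventually.of_forall fun x ↦ abs_nonneg (C x)) hint.abs
  obtain ⟨a, h₁, h₂⟩ :=
    ((hT.eventually (eventually_gt_atTop (∫ x in b..aStar, |C x|))).and hbound).exists
  exact (lt_irrefl _) (h₁.trans_le h₂)

/-- **The canonical rate at a conjugate point.** If `ε > 0` on `(0, a⋆)` and `ε a⋆ = 0` (`a⋆ > 0`), then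
for every `0 < b < a⋆` the canonical rate `C₀ = -(log ∘ ε)'` — which realises the law with equality on
`[b, a]` for every `a < a⋆` — has `∫_b^a C₀ → +∞` (`a → a⋆⁻`) and is not integrable on `[b, a⋆]`.
[folklore] -/
theorem canonicalRate_blowup_of_conjugatePoint {aStar b : ℝ} (hb : 0 < b) (hbS : b < aStar)
    (hzero : weilGroundEnergy aStar = 0)
    (hpos : ∀ a : ℝ, 0 < a → a < aStar → 0 < weilGroundEnergy a) :
    Tendsto (fun a ↦ ∫ x in b..a, -deriv (fun y ↦ Real.log (weilGroundEnergy y)) x)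
        (𝓝[<] aStar) atTop ∧
      ¬ IntervalIntegrable (fun x ↦ -deriv (fun y ↦ Real.log (weilGroundEnergy y)) x)
        volume b aStar := by
  have hlaw : ∀ a : ℝ, b ≤ a → a < aStar →
      weilGroundEnergy b *
          Real.exp (-(∫ x in b..a, -deriv (fun y ↦ Real.log (weilGroundEnergy y)) x)) ≤
        weilGroundEnergy a :=
    fun a hba hlt ↦ (leakage_identity_of_pos hb hba (hpos a (hb.trans_le hba) hlt)).2.le
  exact ⟨rate_integral_tendsto_atTop_of_conjugatePoint hb hbS hzero hpos hlaw,
    rate_not_intervalIntegrable_of_conjugatePoint hb hbS hzero hpos hlaw⟩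

end Summit.RiemannHypothesis.RiemannHypothesis.Theorems.WeilWindowFlowGronwallLeakage

end
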